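import Mathlib
import Summits.Ventures.PercRepro2.TypedMarkedSeriesDefs
import Summits.Ventures.PercRepro2.TypedMarkedSeriesGraph
import Summits.Ventures.PercRepro2.TypedMarkedSeriesStateA
import Summits.Ventures.PercRepro2.TypedMarkedSeriesStateCD
import Summits.Ventures.PercRepro2.TypedMarkedSeriesIdA1
import Summits.Ventures.PercRepro2.TypedMarkedSeriesIdA2
import Summits.Ventures.PercRepro2.TypedMarkedSeriesIdC1
import Summits.Ventures.PercRepro2.TypedMarkedSeriesIdC2
import Summits.Ventures.PercRepro2.TypedMarkedSeriesIdD1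
import Summits.Ventures.PercRepro2.TypedMarkedSeriesIdD2
import Summits.Ventures.PercRepro2.TypedSwapRoots

/-!
# The four marked-series vanishing rules of row 2′TRI (blind cell PercRepro2, night-3 g13,
2026-08-27; `proofs/NIGHT3-CERT.md` §22)

**Every typed base of `K₃` vanishes** when a mark of degree two sits between two other marks of the
following kinds (the two edges typed with types in `{1, 2}`, every other edge at the mark pinned
closed and untyped; the rest of the instance arbitrary):

* rule A — `o` between `a₁` and `a₃` (`typedCount_eq_zero_of_o_between_a1_a3`);
* rule B — `o` between `a₂` and `a₃` (`typedCount_eq_zero_of_o_between_a2_a3`, by the root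
  symmetry `typedCount_swap_roots`);
* rule C — `o` between the two roots (`typedCount_eq_zero_of_o_between_roots`);
* rule D — `b` between the two roots (`typedCount_eq_zero_of_b_between_roots`).

Mechanism (`typedCount_eq_zero_of_model`): six times the typed base is the typed count of the
`S₃`-symmetrised kernel on states (`six_mul_typedCount`); splitting the count at the two edges
(`typedCount_split`) and reading the states through the signature model (`st_modelA/C/D`) turns
the integrand into the nine-term colouring sum `S9` of the model at the signature triple of the
three copies, which vanishes on every consistent signature triple (`identA/C/D_kl`, `decide`);
the signatures of configurations are consistent (`consB_sig`).

Equality-locus reading (night-3 g13, `data/night-3/g13/`): of the 1,572 identically-vanishing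
instances of the ∣F∣ = 9 domain of record (22,739 instances × 512 type vectors, 0 negative),
922 are explained by these four rules (253 + 416 + 253).  The weighted reading: `Gc ≡ 0` as a
polynomial in the weights on every such instance (Bernstein uniqueness).  Nothing here asserts
anything about the original lane.
-/

namespace Summit.Ventures.PercRepro2

open UnionCluster

namespace CovForm

namespace MarkedSeries

open OneTyped TypedA3 Untouched TypedRed

section Linearity

variable {E : Type*} [Fintype E] [DecidableEq E] {R : Type*} [CommRing R]

/-- A finite sum of guarded typed counts is the typed count of the guarded sum of the kernels. -/
lemma typedCount_sum_ite {ι : Type*} (s : Finset ι) (P : ι → Prop) [DecidablePred P]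
    (F : Finset E) (z : Config E) (τ : E → ℕ) (K : ι → Config E → Config E → Config E → R) :
    (∑ i ∈ s, if P i then typedCount F z τ (K i) else 0) =
      typedCount F z τ (fun x y w => ∑ i ∈ s, if P i then K i x y w else 0) := by
  unfold typedCount
  have h1 : ∀ i, (if P i then (∑ x : Config E, ∑ y : Config E, ∑ w : Config E,
      if (∀ e, e ∉ F → x e = z e ∧ y e = z e ∧ w e = z e) ∧ (∀ e ∈ F, openCount x y w e = τ e)
        then K i x y w else 0) else 0) =
      ∑ x : Config E, ∑ y : Config E, ∑ w : Config E,
        if (∀ e, e ∉ F → x e = z e ∧ y e = z e ∧ w e = z e) ∧ (∀ e ∈ F, openCount x y w e = τ e)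
          then (if P i then K i x y w else 0) else 0 := by
    intro i
    by_cases hP : P i
    · simp only [hP, if_true]
    · simp only [hP, if_false, ite_self, Finset.sum_const_zero]
  have h2 : ∀ x y w : Config E, (if (∀ e, e ∉ F → x e = z e ∧ y e = z e ∧ w e = z e) ∧
      (∀ e ∈ F, openCount x y w e = τ e) then (∑ i ∈ s, if P i then K i x y w else 0) else 0) =
      ∑ i ∈ s, if (∀ e, e ∉ F → x e = z e ∧ y e = z e ∧ w e = z e) ∧
        (∀ e ∈ F, openCount x y w e = τ e) then (if P i then K i x y w else 0) else 0 := by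
    intro x y w
    by_cases hs : (∀ e, e ∉ F → x e = z e ∧ y e = z e ∧ w e = z e) ∧
      (∀ e ∈ F, openCount x y w e = τ e)
    · simp only [if_pos hs]
    · simp only [if_neg hs, Finset.sum_const_zero]
  simp only [h1, h2]
  rw [Finset.sum_comm]
  refine Finset.sum_congr rfl fun x _ => ?_
  rw [Finset.sum_comm]
  refine Finset.sum_congr rfl fun y _ => ?_
  rw [Finset.sum_comm]

/-- A finite sum of typed counts is the typed count of the sum of the kernels. -/
lemma typedCount_sum {ι : Type*} (s : Finset ι) (F : Finset E) (z : Config E) (τ : E → ℕ)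
    (K : ι → Config E → Config E → Config E → R) :
    (∑ i ∈ s, typedCount F z τ (K i)) = typedCount F z τ (fun x y w => ∑ i ∈ s, K i x y w) := by
  unfold typedCount
  have h2 : ∀ x y w : Config E, (if (∀ e, e ∉ F → x e = z e ∧ y e = z e ∧ w e = z e) ∧
      (∀ e ∈ F, openCount x y w e = τ e) then (∑ i ∈ s, K i x y w) else 0) =
      ∑ i ∈ s, if (∀ e, e ∉ F → x e = z e ∧ y e = z e ∧ w e = z e) ∧
        (∀ e ∈ F, openCount x y w e = τ e) then K i x y w else 0 := by
    intro x y w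
    by_cases hs : (∀ e, e ∉ F → x e = z e ∧ y e = z e ∧ w e = z e) ∧
      (∀ e ∈ F, openCount x y w e = τ e)
    · simp only [if_pos hs]
    · simp only [if_neg hs, Finset.sum_const_zero]
  simp only [h2]
  rw [Finset.sum_comm]
  refine Finset.sum_congr rfl fun x _ => ?_
  rw [Finset.sum_comm]
  refine Finset.sum_congr rfl fun y _ => ?_
  rw [Finset.sum_comm]

end Linearity

section Assembly

open Classical

variable {V : Type*} {E : Type*} [Fintype E] [DecidableEq E] {R : Type*} [Field R]
  [LinearOrder R] [IsStrictOrderedRing R]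
variable (ends : E → Sym2 V) (o a₁ a₂ a₃ b : V)

omit [LinearOrder R] [IsStrictOrderedRing R] in
/-- Six times the typed base is the typed count of the symmetrised kernel on states. -/
lemma six_mul_typedCount_KBsym (F : Finset E) (z : Config E) (τ : E → ℕ)
    (hτ : ∀ e ∈ F, τ e = 1 ∨ τ e = 2) :
    6 * typedCount F z τ (K3 ends o a₁ a₂ a₃ b : Config E → Config E → Config E → R) =
      typedCount F z τ (fun x y w => ((KBsym (st ends o a₁ a₂ a₃ b x) (st ends o a₁ a₂ a₃ b y)
        (st ends o a₁ a₂ a₃ b w) : ℤ) : R)) := by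
  rw [six_mul_typedCount F z τ hτ]
  refine typedCount_congr' F z τ _ _ fun x y w => ?_
  simp only [K3_eq_KB ends o a₁ a₂ a₃ b]
  unfold KBsym
  push_cast
  ring

omit [LinearOrder R] [IsStrictOrderedRing R] in
/-- The nine-term colouring sum, as the guarded Boolean sums of the split. -/
lemma sum_split_eq_S9 (k l : ℕ) (hk : k = 1 ∨ k = 2) (hl : l = 1 ∨ l = 2)
    (m₁ m₂ m₃ : Bool → Bool → St) :
    (∑ a : Bool, ∑ b' : Bool, ∑ c : Bool, if a.toNat + b'.toNat + c.toNat = l then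
      (∑ p : Bool, ∑ q : Bool, ∑ r : Bool, if p.toNat + q.toNat + r.toNat = k then
        ((KBsym (m₁ p a) (m₂ q b') (m₃ r c) : ℤ) : R) else 0) else 0) =
      ((S9 k l m₁ m₂ m₃ : ℤ) : R) := by
  rcases hk with rfl | rfl <;> rcases hl with rfl | rfl <;> simp [S9, cols] <;> ring

/-- **The generic marked-series vanishing theorem.**  Given a model `md` of the states of the
copies from a six-bit signature of the configuration with the two edges closed (`hst`, on the
support), consistent signatures (`hcons`) and the vanishing of the nine-term colouring sum of the
model on consistent signature triples (`hid`), the typed base vanishes. -/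
theorem typedCount_eq_zero_of_model (F : Finset E) (z : Config E) (τ : E → ℕ)
    (hτ : ∀ e ∈ F, τ e = 1 ∨ τ e = 2) {e f : E} (hef : e ≠ f) (heF : e ∈ F) (hfF : f ∈ F)
    (md : Bool → Bool → Bool → Bool → Bool → Bool → Bool → Bool → St)
    (s1 s2 s3 s4 s5 s6 : Config E → Bool)
    (hcons : ∀ x, consB (s1 x) (s2 x) (s3 x) (s4 x) (s5 x) (s6 x) = true)
    (hst : ∀ x : Config E, (∀ e', e' ∉ (F.erase f).erase e →
        x e' = Function.update (Function.update z f false) e false e') → ∀ p a : Bool,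
      st ends o a₁ a₂ a₃ b (Function.update (Function.update x e p) f a) =
        md (s1 x) (s2 x) (s3 x) (s4 x) (s5 x) (s6 x) p a)
    (hid : ∀ k l : ℕ, (k = 1 ∨ k = 2) → (l = 1 ∨ l = 2) →
      ∀ c1 c2 c3 c4 c5 c6 : Bool, consB c1 c2 c3 c4 c5 c6 = true →
      ∀ d1 d2 d3 d4 d5 d6 : Bool, consB d1 d2 d3 d4 d5 d6 = true →
      ∀ e1 e2 e3 e4 e5 e6 : Bool, consB e1 e2 e3 e4 e5 e6 = true →
      S9 k l (md c1 c2 c3 c4 c5 c6) (md d1 d2 d3 d4 d5 d6) (md e1 e2 e3 e4 e5 e6) = 0) :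
    typedCount F z τ (K3 ends o a₁ a₂ a₃ b : Config E → Config E → Config E → R) = 0 := by
  have h6 := six_mul_typedCount_KBsym (R := R) ends o a₁ a₂ a₃ b F z τ hτ
  have heF' : e ∈ F.erase f := Finset.mem_erase.2 ⟨hef, heF⟩
  have hk := hτ e heF
  have hl := hτ f hfF
  -- the split at `f` then `e`, the states read through the model
  have hsplit : typedCount F z τ (fun x y w => ((KBsym (st ends o a₁ a₂ a₃ b x)
      (st ends o a₁ a₂ a₃ b y) (st ends o a₁ a₂ a₃ b w) : ℤ) : R)) =
      ∑ a : Bool, ∑ b' : Bool, ∑ c : Bool, if a.toNat + b'.toNat + c.toNat = τ f then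
        (∑ p : Bool, ∑ q : Bool, ∑ r : Bool, if p.toNat + q.toNat + r.toNat = τ e then
          typedCount ((F.erase f).erase e) (Function.update (Function.update z f false) e false) τ
            (fun x y w => ((KBsym (md (s1 x) (s2 x) (s3 x) (s4 x) (s5 x) (s6 x) p a)
              (md (s1 y) (s2 y) (s3 y) (s4 y) (s5 y) (s6 y) q b')
              (md (s1 w) (s2 w) (s3 w) (s4 w) (s5 w) (s6 w) r c) : ℤ) : R)) else 0) else 0 := by
    rw [typedCount_split F f hfF]
    refine Finset.sum_congr rfl fun a _ => Finset.sum_congr rfl fun b' _ =>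
      Finset.sum_congr rfl fun c _ => ?_
    refine if_congr Iff.rfl ?_ rfl
    rw [typedCount_split (F.erase f) e heF']
    refine Finset.sum_congr rfl fun p _ => Finset.sum_congr rfl fun q _ =>
      Finset.sum_congr rfl fun r _ => ?_
    refine if_congr Iff.rfl ?_ rfl
    refine typedCount_congr_on_support _ _ _ fun x y w hxyw _ => ?_
    rw [hst x (fun e' he' => (hxyw e' he').1) p a, hst y (fun e' he' => (hxyw e' he').2.1) q b',
      hst w (fun e' he' => (hxyw e' he').2.2) r c]
  -- the guarded sums move inside the count
  have hin : (∑ a : Bool, ∑ b' : Bool, ∑ c : Bool, if a.toNat + b'.toNat + c.toNat = τ f then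
        (∑ p : Bool, ∑ q : Bool, ∑ r : Bool, if p.toNat + q.toNat + r.toNat = τ e then
          typedCount ((F.erase f).erase e) (Function.update (Function.update z f false) e false) τ
            (fun x y w => ((KBsym (md (s1 x) (s2 x) (s3 x) (s4 x) (s5 x) (s6 x) p a)
              (md (s1 y) (s2 y) (s3 y) (s4 y) (s5 y) (s6 y) q b')
              (md (s1 w) (s2 w) (s3 w) (s4 w) (s5 w) (s6 w) r c) : ℤ) : R)) else 0) else 0) =
      typedCount ((F.erase f).erase e) (Function.update (Function.update z f false) e false) τ
        (fun x y w => ∑ a : Bool, ∑ b' : Bool, ∑ c : Bool,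
          if a.toNat + b'.toNat + c.toNat = τ f then
            (∑ p : Bool, ∑ q : Bool, ∑ r : Bool, if p.toNat + q.toNat + r.toNat = τ e then
              ((KBsym (md (s1 x) (s2 x) (s3 x) (s4 x) (s5 x) (s6 x) p a)
                (md (s1 y) (s2 y) (s3 y) (s4 y) (s5 y) (s6 y) q b')
                (md (s1 w) (s2 w) (s3 w) (s4 w) (s5 w) (s6 w) r c) : ℤ) : R) else 0) else 0) := by
    simp only [typedCount_sum_ite, typedCount_sum]
  -- the integrand is the nine-term sum of the model, which vanishes
  have hzero : typedCount ((F.erase f).erase e) (Function.update (Function.update z f false) e false) τ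
        (fun x y w => ∑ a : Bool, ∑ b' : Bool, ∑ c : Bool,
          if a.toNat + b'.toNat + c.toNat = τ f then
            (∑ p : Bool, ∑ q : Bool, ∑ r : Bool, if p.toNat + q.toNat + r.toNat = τ e then
              ((KBsym (md (s1 x) (s2 x) (s3 x) (s4 x) (s5 x) (s6 x) p a)
                (md (s1 y) (s2 y) (s3 y) (s4 y) (s5 y) (s6 y) q b')
                (md (s1 w) (s2 w) (s3 w) (s4 w) (s5 w) (s6 w) r c) : ℤ) : R) else 0) else 0) =
      typedCount ((F.erase f).erase e) (Function.update (Function.update z f false) e false) τ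
        (fun _ _ _ => (0 : R)) := by
    refine typedCount_congr' _ _ _ _ _ fun x y w => ?_
    rw [sum_split_eq_S9 (τ e) (τ f) hk hl, hid (τ e) (τ f) hk hl _ _ _ _ _ _ (hcons x)
      _ _ _ _ _ _ (hcons y) _ _ _ _ _ _ (hcons w)]
    simp
  rw [hsplit, hin, hzero, typedCount_zero_kernel] at h6
  have h6' : (6 : R) ≠ 0 := by norm_num
  exact (mul_eq_zero.mp h6).resolve_left h6'

end Assembly

/-! ## The four rules -/

section Rules

open Classical

variable {V : Type*} {E : Type*} [Fintype E] [DecidableEq E] {R : Type*} [Field R]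
  [LinearOrder R] [IsStrictOrderedRing R]
variable (ends : E → Sym2 V) (o a₁ a₂ a₃ b : V)

/-- **Rule A: `o` between `a₁` and `a₃`.**  If `o` carries exactly the typed edges `e = {a₁, o}`,
`f = {o, a₃}` (every other edge at `o` pinned closed and untyped), every typed base vanishes. -/
theorem typedCount_eq_zero_of_o_between_a1_a3 {e f : E} (hef : e ≠ f) (he : ends e = s(a₁, o))
    (hf : ends f = s(o, a₃)) (ho1 : o ≠ a₁) (ho2 : o ≠ a₂) (ho3 : o ≠ a₃) (hob : o ≠ b)
    (F : Finset E) (heF : e ∈ F) (hfF : f ∈ F) (z : Config E) (τ : E → ℕ)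
    (hτ : ∀ e ∈ F, τ e = 1 ∨ τ e = 2)
    (hcl : ∀ e', e' ≠ e → e' ≠ f → o ∈ ends e' → e' ∉ F ∧ z e' = false) :
    typedCount F z τ (K3 ends o a₁ a₂ a₃ b : Config E → Config E → Config E → R) = 0 := by
  refine typedCount_eq_zero_of_model ends o a₁ a₂ a₃ b F z τ hτ hef heF hfF modelA
    (fun x => decide (Conn ends (Function.update (Function.update x e false) f false) a₁ a₂))
    (fun x => decide (Conn ends (Function.update (Function.update x e false) f false) a₁ b))
    (fun x => decide (Conn ends (Function.update (Function.update x e false) f false) a₁ a₃))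
    (fun x => decide (Conn ends (Function.update (Function.update x e false) f false) a₂ b))
    (fun x => decide (Conn ends (Function.update (Function.update x e false) f false) a₂ a₃))
    (fun x => decide (Conn ends (Function.update (Function.update x e false) f false) b a₃))
    (fun x => consB_sig ends _ a₁ a₂ b a₃) (fun x hx p a => ?_) ?_
  · exact st_modelA ends o a₁ a₂ a₃ b hef he hf ho1 ho2 ho3 hob x (closed_on_support2 F z hcl x hx) p a
  · intro k l hk hl
    rcases hk with rfl | rfl <;> rcases hl with rfl | rfl
    · exact identA_11
    · exact identA_12
    · exact identA_21
    · exact identA_22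

/-- **Rule B: `o` between `a₂` and `a₃`** (the root mirror of rule A). -/
theorem typedCount_eq_zero_of_o_between_a2_a3 {e f : E} (hef : e ≠ f) (he : ends e = s(a₂, o))
    (hf : ends f = s(o, a₃)) (ho1 : o ≠ a₁) (ho2 : o ≠ a₂) (ho3 : o ≠ a₃) (hob : o ≠ b)
    (F : Finset E) (heF : e ∈ F) (hfF : f ∈ F) (z : Config E) (τ : E → ℕ)
    (hτ : ∀ e ∈ F, τ e = 1 ∨ τ e = 2)
    (hcl : ∀ e', e' ≠ e → e' ≠ f → o ∈ ends e' → e' ∉ F ∧ z e' = false) :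
    typedCount F z τ (K3 ends o a₁ a₂ a₃ b : Config E → Config E → Config E → R) = 0 := by
  rw [← SwapRoots.typedCount_swap_roots ends o a₁ a₂ a₃ b F z τ]
  exact typedCount_eq_zero_of_o_between_a1_a3 ends o a₂ a₁ a₃ b hef he hf ho2 ho1 ho3 hob F heF hfF
    z τ hτ hcl

/-- **Rule C: `o` between the two roots.** -/
theorem typedCount_eq_zero_of_o_between_roots {e f : E} (hef : e ≠ f) (he : ends e = s(a₁, o))
    (hf : ends f = s(o, a₂)) (ho1 : o ≠ a₁) (ho2 : o ≠ a₂) (ho3 : o ≠ a₃) (hob : o ≠ b)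
    (F : Finset E) (heF : e ∈ F) (hfF : f ∈ F) (z : Config E) (τ : E → ℕ)
    (hτ : ∀ e ∈ F, τ e = 1 ∨ τ e = 2)
    (hcl : ∀ e', e' ≠ e → e' ≠ f → o ∈ ends e' → e' ∉ F ∧ z e' = false) :
    typedCount F z τ (K3 ends o a₁ a₂ a₃ b : Config E → Config E → Config E → R) = 0 := by
  refine typedCount_eq_zero_of_model ends o a₁ a₂ a₃ b F z τ hτ hef heF hfF modelC
    (fun x => decide (Conn ends (Function.update (Function.update x e false) f false) a₁ a₂))
    (fun x => decide (Conn ends (Function.update (Function.update x e false) f false) a₁ b))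
    (fun x => decide (Conn ends (Function.update (Function.update x e false) f false) a₁ a₃))
    (fun x => decide (Conn ends (Function.update (Function.update x e false) f false) a₂ b))
    (fun x => decide (Conn ends (Function.update (Function.update x e false) f false) a₂ a₃))
    (fun x => decide (Conn ends (Function.update (Function.update x e false) f false) b a₃))
    (fun x => consB_sig ends _ a₁ a₂ b a₃) (fun x hx p a => ?_) ?_
  · exact st_modelC ends o a₁ a₂ a₃ b hef he hf ho1 ho2 ho3 hob x (closed_on_support2 F z hcl x hx) p a
  · intro k l hk hl
    rcases hk with rfl | rfl <;> rcases hl with rfl | rfl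
    · exact identC_11
    · exact identC_12
    · exact identC_21
    · exact identC_22

/-- **Rule D: `b` between the two roots.** -/
theorem typedCount_eq_zero_of_b_between_roots {e f : E} (hef : e ≠ f) (he : ends e = s(a₁, b))
    (hf : ends f = s(b, a₂)) (hb1 : b ≠ a₁) (hb2 : b ≠ a₂) (hb3 : b ≠ a₃) (hbo : b ≠ o)
    (F : Finset E) (heF : e ∈ F) (hfF : f ∈ F) (z : Config E) (τ : E → ℕ)
    (hτ : ∀ e ∈ F, τ e = 1 ∨ τ e = 2)
    (hcl : ∀ e', e' ≠ e → e' ≠ f → b ∈ ends e' → e' ∉ F ∧ z e' = false) :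
    typedCount F z τ (K3 ends o a₁ a₂ a₃ b : Config E → Config E → Config E → R) = 0 := by
  refine typedCount_eq_zero_of_model ends o a₁ a₂ a₃ b F z τ hτ hef heF hfF modelD
    (fun x => decide (Conn ends (Function.update (Function.update x e false) f false) a₁ a₂))
    (fun x => decide (Conn ends (Function.update (Function.update x e false) f false) a₁ o))
    (fun x => decide (Conn ends (Function.update (Function.update x e false) f false) a₁ a₃))
    (fun x => decide (Conn ends (Function.update (Function.update x e false) f false) a₂ o))
    (fun x => decide (Conn ends (Function.update (Function.update x e false) f false) a₂ a₃))
    (fun x => decide (Conn ends (Function.update (Function.update x e false) f false) o a₃))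
    (fun x => consB_sig ends _ a₁ a₂ o a₃) (fun x hx p a => ?_) ?_
  · exact st_modelD ends o a₁ a₂ a₃ b hef he hf hb1 hb2 hb3 hbo x (closed_on_support2 F z hcl x hx) p a
  · intro k l hk hl
    rcases hk with rfl | rfl <;> rcases hl with rfl | rfl
    · exact identD_11
    · exact identD_12
    · exact identD_21
    · exact identD_22

end Rules

end MarkedSeries

end CovForm

end Summit.Ventures.PercRepro2
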